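import Literature.Claims.NS.Higgins2026
import Literature.Analysis.FluidPDE.NSHopfGalerkinLimit
import Literature.Analysis.FluidPDE.TorusWeakStrongUniqueness
import Literature.Analysis.FunctionSpaces.TorusAgmonExplicit
import Literature.Analysis.FunctionSpaces.TorusVectorParseval
import HarnessLib

/-!
# Solo salvage for claim C158 `Higgins2026` (cell `ns-claims`, D-0090): the Galerkin passage
# (Step 6, p.8 l.41–56) HOLDS — an `N`-uniform Galerkin enstrophy bound passes to every classical
# solution from the same datum

Claim C158: Higgins, «Angular Relaxation on the Integer Lattice and Global Regularity of 3D Navier–Stokes»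
(Zenodo 19601189 v6, 2026); skeleton `Literature.Claims.NS.Higgins2026` (typist-7 g7, p529300). Binder hP
of its composition `claim_of_steps : Theorem26 → GalerkinPassage → Regularity31 → ClaimedTheorem` is the
classical passage «Compactness … Aubin–Lions … Passage of the bound. By weak lower semicontinuity:
Ω(t) ≤ lim inf Ω^(N)(t) ≤ Ω_max» (p.8 l.41–56), typed as: an `N`-uniform bound `B` on the enstrophies of
ALL Galerkin trajectories from `P_N u₀` bounds the enstrophy of EVERY classical solution from `u₀` on its
interval `[0,T)`. This file PROVES it from the tree (no compactness argument is re-done):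

1. the field-level Galerkin trajectories from `P_n u₀` (`Torus.exists_isGalerkinTrajectory_of_isGalerkinMode`)
   form a Hopf–Galerkin scheme (`isHopfGalerkinScheme_of_trajectories`);
2. Hopf's limit: a subsequence converges modewise, at every `t ≥ 0`, to an `L²` field `u`
   (`IsHopfGalerkinScheme.exists_limitField`) which is a Leray–Hopf solution on every `[0,T′)`
   (`IsHopfGalerkinScheme.isLerayHopfOn_limit`);
3. weak–strong uniqueness on `𝕋³` (`Torus.IsLerayHopfOn.ae_eq_of_isClassicalNSSolutionOn`, RRS Thm 6.10):
   `u(t) = v(t)` a.e. for the classical `v` from `u₀`, so their Fourier coefficients agree;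
4. lower semicontinuity over finite frequency sets: Parseval for the gradient
   (`Torus.hasSum_freq_mul_norm_sq_mFourierCoeff`) turns the uniform bound on `‖∇U_N(t)‖₂²` into
   `‖∇v(t)‖₂² ≤ 8π²B` (`gradNormSq_le_of_tendsto_mFourierCoeff`).

* `galerkinPassage_holds : Literature.Claims.NS.Higgins2026.GalerkinPassage`.

After it, the undischarged binder of `claim_of_steps` is exactly `Theorem26` (the refuter's token). TRUE
mathematics only; salvage seat `ns-claims-salvage-p5` g4. Solo lane (no item).

WHAT THIS IS NOT: not a claim about NS regularity or blow-up; not a claim about any author beyond the typed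
locator.
-/

-- lint debt (one line): the Theorems namespace repeats the summit name by the D-0017 layout.
set_option linter.dupNamespace false

noncomputable section

open Set Filter MeasureTheory Topology UnitAddTorus
open scoped ENNReal NNReal RealInnerProductSpace

namespace Summit.NavierStokesRegularity.NavierStokesRegularity.Theorems.Higgins2026Salvage

open Literature.Analysis.FunctionSpaces Literature.Analysis.FluidPDE
open Literature.Claims.NS.Higgins2026

/-! ## 1. Truncations are Galerkin modes; the trajectories form a Hopf–Galerkin scheme -/

/-- `P_N` of an `L²`, weakly divergence-free field is a Galerkin mode of order `N` (smooth, divergence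
free, no modes outside `|k|² ≤ N²`). [cite: RobinsonRodrigoSadowski2016, §4.1 (4.1) and Lemma 2.9] -/
theorem isGalerkinMode_fourierTruncate {v : T3 → E3} (hv : MemLp v 2 volume)
    (hdiv : Torus.IsWeaklyDivFree v) (N : ℕ) : IsGalerkinMode N (Torus.fourierTruncate N v) := by
  refine ⟨Torus.isSmooth_fourierTruncate N v, Torus.isDivFree_fourierTruncate hv hdiv N, fun k hk => ?_⟩
  rw [Torus.mFourierCoeff_fourierTruncate (hv.integrable one_le_two) N k,
    if_neg (Torus.not_mem_freqBall.mpr hk)]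

/-- **Field-level Galerkin trajectories of orders `n = 0, 1, 2, …` from the truncations `P_n u₀` form a
Hopf–Galerkin scheme for `(ν, 0, u₀)`** (`u₀ ∈ L²` weakly divergence free; unforced): every clause of the
scheme is a clause of `Torus.IsGalerkinTrajectory`, the data clause is `⟪P_n u₀, a⟫ = ⟪u₀, a⟫` for
band-limited `a`, and `P_n u₀ → u₀` in `L²`. [cite: RobinsonRodrigoSadowski2016, Thm. 4.4 Steps 1–2, Lemma 4.1] -/
theorem isHopfGalerkinScheme_of_trajectories {ν : ℝ} {u₀ : T3 → E3} (hu₀ : MemLp u₀ 2 volume)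
    {U : ℕ → ℝ → T3 → E3} (hU : ∀ n, Torus.IsGalerkinTrajectory ν 0 n (U n))
    (h0 : ∀ n, U n 0 = Torus.fourierTruncate n u₀) :
    IsHopfGalerkinScheme ν (0 : ℝ → T3 → E3) u₀ id (0 : ℕ → ℝ → T3 → E3) U where
  tendsto_order := tendsto_id
  smooth_force n := by
    show ContDiff ℝ _ (fun _ => (0 : E3))
    exact contDiff_const
  tendsto_force T hT := by simp
  continuousOn n := (hU n).continuousOn
  isGalerkinMode n t ht := (hU n).isGalerkinMode t ht
  isWeaklyDivFree n t ht := (hU n).isWeaklyDivFree t ht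
  galerkin n a ha s t hs hst := (hU n).galerkin a ha s t hs hst
  energy_eq n s t hs hst := (hU n).energy_eq s t hs hst
  initial_inner n a ha := by
    rw [h0 n]
    exact Torus.integral_inner_fourierTruncate_eq hu₀ (ha.isSmooth.memLp 2)
      fun k hk => ha.2.2 k (Torus.not_mem_freqBall.mp hk)
  tendsto_initial := by
    have h := Torus.tendsto_eLpNorm_fourierTruncate_sub hu₀
    refine h.congr fun n => ?_
    simp only [h0 n]

/-! ## 2. Lower semicontinuity of `‖∇·‖₂²` under modewise convergence -/

/-- **Parseval lower semicontinuity for the gradient**: if the Fourier coefficients of smooth fields `W j`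
converge modewise to those of a smooth field `v` and `‖∇W j‖₂² ≤ C` for all `j`, then `‖∇v‖₂² ≤ C`
(every finite partial sum of `Σ_k 4π²|k|²‖v̂(k)‖²` is a limit of partial sums bounded by `C`).
[cite: Grafakos2014, Prop. 3.2.7 (3)] -/
theorem gradNormSq_le_of_tendsto_mFourierCoeff {v : T3 → E3} (hv : Torus.IsSmooth v)
    {W : ℕ → T3 → E3} (hW : ∀ j, Torus.IsSmooth (W j)) {C : ℝ} (hC : ∀ j, Torus.gradNormSq (W j) ≤ C)
    (hc : ∀ k : Fin 3 → ℤ, Tendsto (fun j => mFourierCoeff (EuclideanSpace.complexify ∘ W j) k) atTop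
      (𝓝 (mFourierCoeff (EuclideanSpace.complexify ∘ v) k))) :
    Torus.gradNormSq v ≤ C := by
  have hsum := Torus.hasSum_freq_mul_norm_sq_mFourierCoeff hv
  have hnn : ∀ w : T3 → E3, ∀ k : Fin 3 → ℤ,
      0 ≤ 4 * Real.pi ^ 2 * Torus.freqNormSq k * ‖mFourierCoeff (EuclideanSpace.complexify ∘ w) k‖ ^ 2 :=
    fun w k => by have := Torus.freqNormSq_nonneg k; positivity
  -- every finite partial sum of the limit is `≤ C`
  have hF : ∀ F : Finset (Fin 3 → ℤ),
      ∑ k ∈ F, 4 * Real.pi ^ 2 * Torus.freqNormSq k * ‖mFourierCoeff (EuclideanSpace.complexify ∘ v) k‖ ^ 2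
        ≤ C := by
    intro F
    have hlim : Tendsto (fun j => ∑ k ∈ F, 4 * Real.pi ^ 2 * Torus.freqNormSq k *
        ‖mFourierCoeff (EuclideanSpace.complexify ∘ W j) k‖ ^ 2) atTop
        (𝓝 (∑ k ∈ F, 4 * Real.pi ^ 2 * Torus.freqNormSq k *
          ‖mFourierCoeff (EuclideanSpace.complexify ∘ v) k‖ ^ 2)) :=
      tendsto_finsetSum F fun k _ => (((hc k).norm.pow 2).const_mul _)
    refine le_of_tendsto' hlim fun j => ?_
    calc ∑ k ∈ F, 4 * Real.pi ^ 2 * Torus.freqNormSq k *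
          ‖mFourierCoeff (EuclideanSpace.complexify ∘ W j) k‖ ^ 2
        ≤ Torus.gradNormSq (W j) :=
          sum_le_hasSum F (fun k _ => hnn (W j) k) (Torus.hasSum_freq_mul_norm_sq_mFourierCoeff (hW j))
      _ ≤ C := hC j
  rw [← hsum.tsum_eq]
  exact hsum.summable.tsum_le_of_sum_le hF

/-! ## 3. The passage -/

/-- **Step 6 of C158 HOLDS** (p.8 l.41–56, «Compactness … Passage of the bound»): for `ν > 0`, a smooth
divergence-free `u₀` on `𝕋³` and `B ∈ ℝ`, if EVERY field-level Galerkin trajectory from `P_N u₀` (every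
`N`) has enstrophy `≤ B` for all `t ≥ 0`, then every classical solution `v` of the unforced system on
`[0,T) × 𝕋³` with `v(0) = u₀` has enstrophy `≤ B` on `[0,T)`. Proof: Hopf–Galerkin limit (tree) + weak–strong
uniqueness on `𝕋³` (tree) + Parseval lower semicontinuity; at `t = 0` directly from `P_N u₀ → u₀` modewise.
[cite: Higgins2026, Thm 3.1 proof p.8 l.41–56] [cite: RobinsonRodrigoSadowski2016, Thm. 4.4, Thm. 6.10] -/
theorem galerkinPassage_holds : GalerkinPassage := by
  intro ν hν u₀ hu₀ B hB T v q hv hv0 t ht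
  have hsm : Torus.IsSmooth u₀ := hu₀.1
  have hL2 : MemLp u₀ 2 volume := hsm.memLp 2
  have hwdf : Torus.IsWeaklyDivFree u₀ := hu₀.2.isWeaklyDivFree_holds hsm
  have hπ : (0 : ℝ) < 8 * Real.pi ^ 2 := by positivity
  -- the Galerkin trajectories from `P_n u₀` and their uniform enstrophy bound
  have hex : ∀ n : ℕ, ∃ W : ℝ → T3 → E3,
      Torus.IsGalerkinTrajectory ν 0 n W ∧ W 0 = Torus.fourierTruncate n u₀ := fun n =>
    Torus.exists_isGalerkinTrajectory_of_isGalerkinMode hν.le (memLp_const 0)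
      (isGalerkinMode_fourierTruncate hL2 hwdf n)
  choose U hU hU0 using hex
  have hUB : ∀ n s, 0 ≤ s → Torus.gradNormSq (U n s) ≤ 8 * Real.pi ^ 2 * B := by
    intro n s hs
    have h := hB n (U n) ⟨hU n, hU0 n⟩ s hs
    unfold Literature.Claims.NS.Higgins2026.enstrophy at h
    rwa [div_le_iff₀ hπ, mul_comm] at h
  -- `t = 0`: the truncations themselves converge modewise to `u₀ = v 0`
  rcases ht.1.eq_or_lt with h0 | htpos
  · subst h0
    rw [hv0]
    have hle : Torus.gradNormSq u₀ ≤ 8 * Real.pi ^ 2 * B := by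
      refine gradNormSq_le_of_tendsto_mFourierCoeff hsm (W := fun n => U n 0)
        (fun n => ((hU n).isGalerkinMode 0 le_rfl).isSmooth) (fun n => hUB n 0 le_rfl) fun k => ?_
      refine tendsto_const_nhds.congr' ?_
      have hev : ∀ᶠ n : ℕ in atTop, k ∈ Torus.freqBall n := by
        refine (eventually_ge_atTop ⌈Real.sqrt (Torus.freqNormSq k)⌉₊).mono fun n hn => ?_
        by_contra hkn
        have hlt := Torus.not_mem_freqBall.mp hkn
        have h1 : Real.sqrt (Torus.freqNormSq k) ≤ n := (Nat.le_ceil _).trans (by exact_mod_cast hn)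
        have h2 : 0 ≤ Real.sqrt (Torus.freqNormSq k) := Real.sqrt_nonneg _
        nlinarith [Real.sq_sqrt (Torus.freqNormSq_nonneg k), h1, h2, mul_le_mul h1 h1 h2 (Nat.cast_nonneg n)]
      filter_upwards [hev] with n hn
      rw [hU0 n, Torus.mFourierCoeff_fourierTruncate (hL2.integrable one_le_two) n k, if_pos hn]
    unfold Literature.Claims.NS.Higgins2026.enstrophy
    rwa [div_le_iff₀ hπ, mul_comm]
  · -- `t > 0`: Hopf limit + weak–strong uniqueness
    have hS := isHopfGalerkinScheme_of_trajectories hL2 hU hU0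
    have hfm : AEStronglyMeasurable (Torus.stLift (0 : ℝ → T3 → E3))
        (volume.restrict (Ioi 0 ×ˢ univ)) := by
      show AEStronglyMeasurable (fun _ => (0 : E3)) _
      exact aestronglyMeasurable_const
    have hf₂ : ∀ T' : ℝ, 0 < T' → ∫⁻ s in Ioo 0 T', ∫⁻ x : T3, ‖(0 : ℝ → T3 → E3) s x‖ₑ ^ 2 < ⊤ := by
      intro T' _; simp
    obtain ⟨φ, hφ, u, hum, huL2, hc⟩ := hS.exists_limitField hν.le hL2 hfm hf₂
    have hS' := hS.comp_strictMono hφ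
    have hLH : Torus.IsLerayHopfOn t ν 0 u₀ u :=
      hS'.isLerayHopfOn_limit hν hL2 hwdf hfm hf₂ hum huL2 hc htpos
    -- the classical solution on `[0, t]`
    have hcl : Torus.IsClassicalNSSolutionOn (Icc 0 t) ν 0 v q :=
      hv.mono (Icc_subset_Ico_right ht.2) (uniqueDiffOn_Icc htpos)
    rw [← hv0] at hLH
    have hae : u t =ᵐ[volume] v t :=
      hLH.ae_eq_of_isClassicalNSSolutionOn hcl (convex_Icc 0 t) subset_rfl hν.le htpos t ⟨htpos, le_rfl⟩
    have hvs : Torus.IsSmooth (v t) := hv.smooth_velocity.isSmooth_slice ht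
    have hle : Torus.gradNormSq (v t) ≤ 8 * Real.pi ^ 2 * B := by
      refine gradNormSq_le_of_tendsto_mFourierCoeff hvs (W := fun j => U (φ j) t)
        (fun j => ((hU (φ j)).isGalerkinMode t ht.1).isSmooth) (fun j => hUB (φ j) t ht.1) fun k => ?_
      have hk := hc t ht.1 k
      rwa [Torus.mFourierCoeff_congr_ae (hae.fun_comp EuclideanSpace.complexify) k] at hk
    unfold Literature.Claims.NS.Higgins2026.enstrophy
    rwa [div_le_iff₀ hπ, mul_comm]

end Summit.NavierStokesRegularity.NavierStokesRegularity.Theorems.Higgins2026Salvage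

end

-- WHAT THIS IS NOT: not a claim about NS regularity or blow-up; not a claim about any author beyond the
-- typed locator.
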